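import Summits.QuantumFields.YangMills.Theorems.BalabanUVNodesN13UV01LevelZeroOfNormalisationLettersAtRecord13
import Literature.MathematicalPhysics.QuantumFieldTheory.Balaban1983to89.Node00.Record13NumericsOfThm1CCMZ

/-!
# BalabanUVNodes ∕ N13 — [III] Cor. 3 (2.50) AT LEVEL `0` AT THE z-WITNESS FAMILY `theta13OfThm1CCMWZ … Efl logz` (DEF-1's Z2) WITH `logz` := PRINT's `log z(g_j², ε)` OF [I] (0.15):
# a NON-coupling-blind member of the K0 witness family whose level-0 face of (B) holds outright (Efl volume-bounded, e.g. `Efl = 0`)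

Cell `pub-ymgap` (D-0062 Track A ∕ D-0149 width), WIDTH SEAT `pub-ymgap-dag-n13-w1` (gen 6, CLAIM-3), key K1⁹ `StabilityBRunRowsAtRecordR13SepCoPHV` = stmt-QuantumFields-27364
(`route-QuantumFields-BalabanUVNodes` rev 29; `--kind proof --supports … --as helper`; count-neutral).  director-ym №218 FLAG №9 (3)–(4): «what must move = the witness»; DEF-1 g9's
Z1 p637981 `Node00/Record12NumericsFamilyDictZ` + Z2 p639492 `Node00/Record13NumericsOfThm1CCMZ` thread the OPEN LETTERS `Efl`, `logz` through the K0 family; this seat's CLAIM-1 p638515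
`…N13UV01LevelZeroOfNormalisationLettersAtRecord13` is the θ-generic level-0 consumer.  THIS FILE instantiates it AT THE Z FAMILY with the printed `z`.

THE POINT.  The Z family's β-functions of record, hence its generated histories `g_j`, its (2.9) species and its backgrounds DO NOT READ the normalisation letters — they are the blind
member's BY `rfl` (k0 lanes' bridges).  So the letter `logz P j := log z((g_j)², ε)` with `g_j` the blind member's history is a legitimate, non-circular choice of the open letter, and by CLAIM-1 §5
(`zItems_of_logz_eq_log_zNorm`: the tree's kernel theorem `B16ZLower.log_zNorm_specialUnitaryGroup_ge` + `z ≤ 1`) it meets both z-items on every γ-windowed run (`aL = d(𝔤)`,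
`CzL = C_z^{SU}(N, ε)`, `aU = CzU = 0`).  Hence (2.50) at level `0` holds at `theta13OfThm1CCMWZ … Efl logz_print` for EVERY volume-bounded `Efl` (§1), in particular at `Efl = 0`
with no hypothesis on the letters at all (§2) — a member of the Z family that is NOT coupling-blind (its `−logz_j·(|T₁^{(j)}|−|T₁^{(j+1)}|) ≈ d(𝔤)·log g_j⁻¹·(…)` is not `O(|T^{(j)*}|)`
uniformly in the coupling, so dag-n13-w3's no-go p636072 ∕ (C) p637054 do not apply to it by their hypotheses).

CONTENTS (the `rfl` bridges β ∕ histories of the Z member = the blind member's are the k0 lanes' `K0Stub3ZWitnessBlind` ∕ `K0NamedZWitnessOfStepTokensGuarded`, imported BY NAME).  §1 ★ `zItems_theta13OfThm1CCMWZ_printedZ` · ★★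
`uv_zero_densOfRecord₁₃_theta13OfThm1CCMWZ_printedZ_of_eflAbs_of_inInterval_of_invSqFloor` (both sides of (2.50) at `k = 0`, every volume-bounded `Efl`; `em = 4·max(log σ₀,0) + C_z^{SU}(N,ε) +
C_E + 12g₀⁻²`, `ep = 4d(𝔤)(log g₀⁻¹ + M∕2) + 4·max(−log σ₀,0) + C_E`) · `…_of_runPartialSumFloor` (row (iv) spelling).  §2 ★★ `uv_zero_densOfRecord₁₃_theta13OfThm1CCMWZ_printedZ_eflZero_…` (`Efl = 0`).

HONEST FRAMING.  Instantiation of CLAIM-1 at DEF-1's Z family by `rfl` bridges; LEVEL 0 ONLY (explicit Wilson weight); the printed `z` enters through the tree's kernel theorem, `Efl`'s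
volume bound is a displayed hypothesis (or `Efl = 0`); nothing of Bałaban's Cor. 3 above level 0 asserted; this does NOT make the Z member a K1⁹ witness (the a.e. rows at levels ≥ 1,
Theorem 1's clause, the provisos `h`, the rows and END are untouched); K1⁹ NEITHER proved NOR refuted; N13 NOT discharged; FLAG №9 NOT closed by this file; counts unmoved
(typed 28∕28 · discharged 5∕27 · A 5∕28); one finite `𝕋⁴_{L^K}` programme at fixed ε; R4 closes the CONDITIONAL finite-𝕋⁴ rung `BalabanLadder.UV` only — the Yang–Mills mass gap
(Clay) is NOT proved by any of this.  No `sorry`, `def`, `instance`, `notation`; standard axioms.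
-/

noncomputable section

open scoped BigOperators

namespace Summit.QuantumFields.YangMills.BalabanUVNodes.N13UV01LevelZeroAtThm1CCMWZOfPrintedZ

open MeasureTheory
open Literature.MathematicalPhysics.QuantumFieldTheory.Balaban1983to89
open Literature.MathematicalPhysics.QuantumFieldTheory.Balaban1983to89.T4Continuum
open Literature.MathematicalPhysics.QuantumFieldTheory.Balaban1983to89.Node00
open Literature.MathematicalPhysics.QuantumFieldTheory.Balaban1983to89.FlowStepRuns (genFlow genSeq genSeq_zero)
open Literature.MathematicalPhysics.QuantumFieldTheory.Balaban1983to89.FlowStep (HBeta prefixOf RGEqH)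
open Summit.QuantumFields.YangMills.BalabanUVNodes.N13UV01LevelZeroOfNormalisationLettersAtRecord13
  (zItems_of_logz_eq_log_zNorm uv_zero_densOfRecord₁₃_of_logz_zNorm_of_eflAbs_of_inInterval_of_invSqFloor)
open Summit.QuantumFields.YangMills.BalabanUVNodes.N13UV01LevelZeroOfPartialSumFloorAtRecord13
  (partialSumFloor_nonneg_of_inInterval inv_sq_gOfRecord₁₃_le_of_inInterval_of_runPartialSumFloor)

variable (F : T4Family) (N : ℕ) [NeZero N] (j : ℕ) (γ ε₀ ε₂₉ B₃ B₃' a₀ a₁ : ℝ) (Efl logz : B12.RunParams → ℕ → ℝ)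

/-! ## §1 (The Z family's β ∕ histories are the blind member's by `rfl` — k0 lanes' `K0Stub3ZWitnessBlind.betaOfRecord₁₃_theta13OfThm1CCMWZ`, `K0NamedZWitnessOfStepTokensGuarded.gOfRecord₁₃_theta13OfThm1CCMWZ`, imported.)  The printed `z` as the open letter: both z-items, and (2.50) at level `0` for every volume-bounded `Efl` -/

/-- ★ **AT THE Z MEMBER WITH `logz P j := log z(g_j², ε)` ALONG THE BLIND MEMBER's HISTORY, BOTH z-ITEMS HOLD ON EVERY γ'-WINDOWED RUN** (`γ' ≤ 1`, `0 < ε`): z-LOWER with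
print's `aL = d(𝔤)`, `CzL = C_z^{SU}(N, ε)`; z-UPPER with `aU = CzU = 0`.  CLAIM-1's `zItems_of_logz_eq_log_zNorm` through the `rfl` bridges. [cite: Balaban1987RG1, (0.14)–(0.17) pp.254–255] -/
theorem zItems_theta13OfThm1CCMWZ_printedZ {ε : ℝ} (hε : 0 < ε) (P : B12.RunParams) {γ' : ℝ} (hγ' : γ' ≤ 1)
    (hI : (genFlow (betaOfRecord₁₃ F N (theta13OfThm1CCMW F N j γ ε₀ ε₂₉ B₃ B₃' a₀ a₁)) P.g0).InInterval γ' P.K) :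
    (∀ i, i < P.K → ((dimSU N : ℕ) : ℝ) * Real.log (gOfRecord₁₃ F N (theta13OfThm1CCMW F N j γ ε₀ ε₂₉ B₃ B₃' a₀ a₁) P i) - B16ZLower.CzSU N ε ≤
        (theta13OfThm1CCMWZ F N j γ ε₀ ε₂₉ B₃ B₃' a₀ a₁ Efl
          (fun p i => Real.log (B16ZLower.zNorm (SU N) (gOfRecord₁₃ F N (theta13OfThm1CCMW F N j γ ε₀ ε₂₉ B₃ B₃' a₀ a₁) p i ^ 2) ε))).logz P i) ∧
      (∀ i, i < P.K → (theta13OfThm1CCMWZ F N j γ ε₀ ε₂₉ B₃ B₃' a₀ a₁ Efl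
          (fun p i => Real.log (B16ZLower.zNorm (SU N) (gOfRecord₁₃ F N (theta13OfThm1CCMW F N j γ ε₀ ε₂₉ B₃ B₃' a₀ a₁) p i ^ 2) ε))).logz P i ≤
        (0 : ℝ) * Real.log (gOfRecord₁₃ F N (theta13OfThm1CCMW F N j γ ε₀ ε₂₉ B₃ B₃' a₀ a₁) P i) + 0) :=
  zItems_of_logz_eq_log_zNorm (theta13OfThm1CCMWZ F N j γ ε₀ ε₂₉ B₃ B₃' a₀ a₁ Efl
    (fun p i => Real.log (B16ZLower.zNorm (SU N) (gOfRecord₁₃ F N (theta13OfThm1CCMW F N j γ ε₀ ε₂₉ B₃ B₃' a₀ a₁) p i ^ 2) ε))) P hε (fun _ _ => rfl) hγ' hI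

/-- ★★ **(2.50) AT LEVEL `0` AT THE Z MEMBER WITH THE PRINTED `z` AND ANY VOLUME-BOUNDED `Efl`** (`|Efl_P(i)| ≤ C_E·|T₁^{(i+1)}|` for `i < K`), along a γ'-windowed run (`γ' ≤ 1`) under the
coupling floor `g_i⁻² ≤ g₀⁻² + M` (`0 ≤ M`): `χβ₀·exp(−g₀⁻²A^η₀ − em·|T₁^{(0)}|) ≤ ρ₀ ≤ exp(ep·|T₁^{(0)}|)`, `em = 4·max(log σ₀,0) + C_z^{SU}(N,ε) + C_E + 12g₀⁻²`, `ep = 4d(𝔤)(log g₀⁻¹ + M∕2)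
+ 4·max(−log σ₀,0) + C_E` — CLAIM-1 §5 at this `θ`. [cite: Balaban1989LargeFieldII, (0.1) pp.355–356; Balaban1988Convergent, (2.50) p.264, Thm 1 p.262, (1.15) p.249; Balaban1987RG1, (0.15) p.254, (0.20) p.256] -/
theorem uv_zero_densOfRecord₁₃_theta13OfThm1CCMWZ_printedZ_of_eflAbs_of_inInterval_of_invSqFloor {ε CE γ' M : ℝ} (hε : 0 < ε) (hCE : 0 ≤ CE) (hγ' : γ' ≤ 1) (hM : 0 ≤ M)
    (P : B12.RunParams) (hE : ∀ i, i < P.K → |Efl P i| ≤ CE * sitesCard (F.P P.K) (i + 1))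
    (hfl : ∀ i, i ≤ P.K → (gOfRecord₁₃ F N (theta13OfThm1CCMW F N j γ ε₀ ε₂₉ B₃ B₃' a₀ a₁) P i ^ 2)⁻¹ ≤ (P.g0 ^ 2)⁻¹ + M)
    (hI : (genFlow (betaOfRecord₁₃ F N (theta13OfThm1CCMW F N j γ ε₀ ε₂₉ B₃ B₃' a₀ a₁)) P.g0).InInterval γ' P.K) (U : GaugeField (F.P P.K) 0 (SU N)) :
    chiβOfRecord₁₃ F N (theta13OfThm1CCMW F N j γ ε₀ ε₂₉ B₃ B₃' a₀ a₁) P.K (gOfRecord₁₃ F N (theta13OfThm1CCMW F N j γ ε₀ ε₂₉ B₃ B₃' a₀ a₁) P) 0 U *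
          Real.exp (-(1 / (gOfRecord₁₃ F N (theta13OfThm1CCMW F N j γ ε₀ ε₂₉ B₃ B₃' a₀ a₁) P 0)) ^ 2 *
              wilsonBGOfRecord F N (theta13OfThm1CCMW F N j γ ε₀ ε₂₉ B₃ B₃' a₀ a₁).εbg P 0 U
            - (4 * max (numerics7OfThm1CCM F.L j ε₀ B₃ B₃' a₀ a₁).logσ₀ 0 + B16ZLower.CzSU N ε + CE
                + 12 * (1 / gOfRecord₁₃ F N (theta13OfThm1CCMW F N j γ ε₀ ε₂₉ B₃ B₃' a₀ a₁) P 0) ^ 2) * (Fintype.card (Site (F.P P.K) 0) : ℝ)) ≤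
        densOfRecord₁₃ F N (theta13OfThm1CCMWZ F N j γ ε₀ ε₂₉ B₃ B₃' a₀ a₁ Efl
          (fun p i => Real.log (B16ZLower.zNorm (SU N) (gOfRecord₁₃ F N (theta13OfThm1CCMW F N j γ ε₀ ε₂₉ B₃ B₃' a₀ a₁) p i ^ 2) ε))) P 0 U ∧
      densOfRecord₁₃ F N (theta13OfThm1CCMWZ F N j γ ε₀ ε₂₉ B₃ B₃' a₀ a₁ Efl
          (fun p i => Real.log (B16ZLower.zNorm (SU N) (gOfRecord₁₃ F N (theta13OfThm1CCMW F N j γ ε₀ ε₂₉ B₃ B₃' a₀ a₁) p i ^ 2) ε))) P 0 U ≤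
        Real.exp ((4 * ((dimSU N : ℕ) : ℝ) * (Real.log (gOfRecord₁₃ F N (theta13OfThm1CCMW F N j γ ε₀ ε₂₉ B₃ B₃' a₀ a₁) P 0)⁻¹ + M / 2)
            + 4 * max (-(numerics7OfThm1CCM F.L j ε₀ B₃ B₃' a₀ a₁).logσ₀) 0 + CE) * (Fintype.card (Site (F.P P.K) 0) : ℝ)) :=
  uv_zero_densOfRecord₁₃_of_logz_zNorm_of_eflAbs_of_inInterval_of_invSqFloor
    (theta13OfThm1CCMWZ F N j γ ε₀ ε₂₉ B₃ B₃' a₀ a₁ Efl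
      (fun p i => Real.log (B16ZLower.zNorm (SU N) (gOfRecord₁₃ F N (theta13OfThm1CCMW F N j γ ε₀ ε₂₉ B₃ B₃' a₀ a₁) p i ^ 2) ε)))
    P hγ' hM hε hCE hfl hI (fun _ _ => rfl) hE U

/-- **THE SAME FROM ROW (iv) IN K1⁹'s INLINE SPELLING** (run-wise partial-sum floor of the blind member's `β` at level `γ₀`, `γ' ≤ γ₀`; p632548 §1 gives the coupling floor, `0 ≤ M`).
[cite: Balaban1989LargeFieldII, (0.1) pp.355–356; Balaban1988Convergent, (2.50) p.264; Balaban1987RG1, (0.20) p.256, Thm 2 p.259, (0.15) p.254] -/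
theorem uv_zero_densOfRecord₁₃_theta13OfThm1CCMWZ_printedZ_of_eflAbs_of_inInterval_of_runPartialSumFloor {ε CE γ' γ₀ M : ℝ} (hε : 0 < ε) (hCE : 0 ≤ CE) (hγ' : γ' ≤ 1)
    (hγ₀ : γ' ≤ γ₀) (P : B12.RunParams) (hE : ∀ i, i < P.K → |Efl P i| ≤ CE * sitesCard (F.P P.K) (i + 1))
    (hps : ∀ (n : ℕ) (gs : ℕ → ℝ), RGEqH n (betaOfRecord₁₃ F N (theta13OfThm1CCMW F N j γ ε₀ ε₂₉ B₃ B₃' a₀ a₁)) gs → Step.InInterval γ₀ n gs →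
      ∀ k, k ≤ n → -M ≤ ∑ i ∈ Finset.Ico k n, betaOfRecord₁₃ F N (theta13OfThm1CCMW F N j γ ε₀ ε₂₉ B₃ B₃' a₀ a₁) i (prefixOf gs i))
    (hI : (genFlow (betaOfRecord₁₃ F N (theta13OfThm1CCMW F N j γ ε₀ ε₂₉ B₃ B₃' a₀ a₁)) P.g0).InInterval γ' P.K) (U : GaugeField (F.P P.K) 0 (SU N)) :
    chiβOfRecord₁₃ F N (theta13OfThm1CCMW F N j γ ε₀ ε₂₉ B₃ B₃' a₀ a₁) P.K (gOfRecord₁₃ F N (theta13OfThm1CCMW F N j γ ε₀ ε₂₉ B₃ B₃' a₀ a₁) P) 0 U *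
          Real.exp (-(1 / (gOfRecord₁₃ F N (theta13OfThm1CCMW F N j γ ε₀ ε₂₉ B₃ B₃' a₀ a₁) P 0)) ^ 2 *
              wilsonBGOfRecord F N (theta13OfThm1CCMW F N j γ ε₀ ε₂₉ B₃ B₃' a₀ a₁).εbg P 0 U
            - (4 * max (numerics7OfThm1CCM F.L j ε₀ B₃ B₃' a₀ a₁).logσ₀ 0 + B16ZLower.CzSU N ε + CE
                + 12 * (1 / gOfRecord₁₃ F N (theta13OfThm1CCMW F N j γ ε₀ ε₂₉ B₃ B₃' a₀ a₁) P 0) ^ 2) * (Fintype.card (Site (F.P P.K) 0) : ℝ)) ≤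
        densOfRecord₁₃ F N (theta13OfThm1CCMWZ F N j γ ε₀ ε₂₉ B₃ B₃' a₀ a₁ Efl
          (fun p i => Real.log (B16ZLower.zNorm (SU N) (gOfRecord₁₃ F N (theta13OfThm1CCMW F N j γ ε₀ ε₂₉ B₃ B₃' a₀ a₁) p i ^ 2) ε))) P 0 U ∧
      densOfRecord₁₃ F N (theta13OfThm1CCMWZ F N j γ ε₀ ε₂₉ B₃ B₃' a₀ a₁ Efl
          (fun p i => Real.log (B16ZLower.zNorm (SU N) (gOfRecord₁₃ F N (theta13OfThm1CCMW F N j γ ε₀ ε₂₉ B₃ B₃' a₀ a₁) p i ^ 2) ε))) P 0 U ≤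
        Real.exp ((4 * ((dimSU N : ℕ) : ℝ) * (Real.log (gOfRecord₁₃ F N (theta13OfThm1CCMW F N j γ ε₀ ε₂₉ B₃ B₃' a₀ a₁) P 0)⁻¹ + M / 2)
            + 4 * max (-(numerics7OfThm1CCM F.L j ε₀ B₃ B₃' a₀ a₁).logσ₀) 0 + CE) * (Fintype.card (Site (F.P P.K) 0) : ℝ)) :=
  uv_zero_densOfRecord₁₃_theta13OfThm1CCMWZ_printedZ_of_eflAbs_of_inInterval_of_invSqFloor F N j γ ε₀ ε₂₉ B₃ B₃' a₀ a₁ Efl hε hCE hγ'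
    (partialSumFloor_nonneg_of_inInterval (theta13OfThm1CCMW F N j γ ε₀ ε₂₉ B₃ B₃' a₀ a₁) P hγ₀ hps hI) P hE
    (inv_sq_gOfRecord₁₃_le_of_inInterval_of_runPartialSumFloor (theta13OfThm1CCMW F N j γ ε₀ ε₂₉ B₃ B₃' a₀ a₁) P hγ₀ hps hI) hI U

/-! ## §2 The hypothesis-free member: `Efl = 0`, `logz` printed -/

/-- ★★ **(2.50) AT LEVEL `0` AT THE Z MEMBER `theta13OfThm1CCMWZ … 0 logz_print` WITH NO HYPOTHESIS ON THE LETTERS** — `Efl = 0` is volume-bounded with `C_E = 0`; along a γ'-windowed run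
(`γ' ≤ 1`) under the coupling floor: `em = 4·max(log σ₀,0) + C_z^{SU}(N,ε) + 12g₀⁻²`, `ep = 4d(𝔤)(log g₀⁻¹ + M∕2) + 4·max(−log σ₀,0)`.  A NON-coupling-blind member of DEF-1's Z family
with its level-0 face in the tree. [cite: Balaban1989LargeFieldII, (0.1) pp.355–356; Balaban1988Convergent, (2.50) p.264, Thm 1 p.262, (1.15) p.249; Balaban1987RG1, (0.15) p.254, (0.20) p.256] -/
theorem uv_zero_densOfRecord₁₃_theta13OfThm1CCMWZ_printedZ_eflZero_of_inInterval_of_invSqFloor {ε γ' M : ℝ} (hε : 0 < ε) (hγ' : γ' ≤ 1) (hM : 0 ≤ M) (P : B12.RunParams)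
    (hfl : ∀ i, i ≤ P.K → (gOfRecord₁₃ F N (theta13OfThm1CCMW F N j γ ε₀ ε₂₉ B₃ B₃' a₀ a₁) P i ^ 2)⁻¹ ≤ (P.g0 ^ 2)⁻¹ + M)
    (hI : (genFlow (betaOfRecord₁₃ F N (theta13OfThm1CCMW F N j γ ε₀ ε₂₉ B₃ B₃' a₀ a₁)) P.g0).InInterval γ' P.K) (U : GaugeField (F.P P.K) 0 (SU N)) :
    chiβOfRecord₁₃ F N (theta13OfThm1CCMW F N j γ ε₀ ε₂₉ B₃ B₃' a₀ a₁) P.K (gOfRecord₁₃ F N (theta13OfThm1CCMW F N j γ ε₀ ε₂₉ B₃ B₃' a₀ a₁) P) 0 U *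
          Real.exp (-(1 / (gOfRecord₁₃ F N (theta13OfThm1CCMW F N j γ ε₀ ε₂₉ B₃ B₃' a₀ a₁) P 0)) ^ 2 *
              wilsonBGOfRecord F N (theta13OfThm1CCMW F N j γ ε₀ ε₂₉ B₃ B₃' a₀ a₁).εbg P 0 U
            - (4 * max (numerics7OfThm1CCM F.L j ε₀ B₃ B₃' a₀ a₁).logσ₀ 0 + B16ZLower.CzSU N ε
                + 12 * (1 / gOfRecord₁₃ F N (theta13OfThm1CCMW F N j γ ε₀ ε₂₉ B₃ B₃' a₀ a₁) P 0) ^ 2) * (Fintype.card (Site (F.P P.K) 0) : ℝ)) ≤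
        densOfRecord₁₃ F N (theta13OfThm1CCMWZ F N j γ ε₀ ε₂₉ B₃ B₃' a₀ a₁ (fun _ _ => 0)
          (fun p i => Real.log (B16ZLower.zNorm (SU N) (gOfRecord₁₃ F N (theta13OfThm1CCMW F N j γ ε₀ ε₂₉ B₃ B₃' a₀ a₁) p i ^ 2) ε))) P 0 U ∧
      densOfRecord₁₃ F N (theta13OfThm1CCMWZ F N j γ ε₀ ε₂₉ B₃ B₃' a₀ a₁ (fun _ _ => 0)
          (fun p i => Real.log (B16ZLower.zNorm (SU N) (gOfRecord₁₃ F N (theta13OfThm1CCMW F N j γ ε₀ ε₂₉ B₃ B₃' a₀ a₁) p i ^ 2) ε))) P 0 U ≤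
        Real.exp ((4 * ((dimSU N : ℕ) : ℝ) * (Real.log (gOfRecord₁₃ F N (theta13OfThm1CCMW F N j γ ε₀ ε₂₉ B₃ B₃' a₀ a₁) P 0)⁻¹ + M / 2)
            + 4 * max (-(numerics7OfThm1CCM F.L j ε₀ B₃ B₃' a₀ a₁).logσ₀) 0) * (Fintype.card (Site (F.P P.K) 0) : ℝ)) := by
  have h := uv_zero_densOfRecord₁₃_theta13OfThm1CCMWZ_printedZ_of_eflAbs_of_inInterval_of_invSqFloor F N j γ ε₀ ε₂₉ B₃ B₃' a₀ a₁ (fun _ _ => 0)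
    hε le_rfl hγ' hM P (fun i _ => by simp) hfl hI U
  simp only [add_zero] at h
  exact h

end Summit.QuantumFields.YangMills.BalabanUVNodes.N13UV01LevelZeroAtThm1CCMWZOfPrintedZ
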